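import Summits.SmoothPoincare4.SmoothPoincare4.Theorems.CylinderEntropyCylinderRungTwoKillingFluxDefs
import Summits.SmoothPoincare4.SmoothPoincare4.Theorems.CylinderEntropyCylinderRungTwoAreaDissipation
import Summits.SmoothPoincare4.SmoothPoincare4.Theorems.CylinderEntropyCylinderRungTwoSlabConfinement
import Summits.SmoothPoincare4.SmoothPoincare4.Theorems.CylinderEntropyCylinderRungTwoFluxIdentityGram
import Literature.Geometry.Riemannian.SphericalCylinderEntropy
import Mathlib.Analysis.SpecificLimits.Basic
import HarnessLib

/-!
# Route `CylinderEntropy`, crux `CylinderRungTwo` (stmt-SmoothPoincare4-7631), line `killing-flux`: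
# `AreaToFloor` from the dissipation budget and area quantization
# (registered helper `helper_areaToFloorOfQuantization`, lead reshape r7)

The immortal half of line `killing-flux` was reduced (reshape r6, `…RelaxationOfAreaToFloor.lean`) to
AREA-TO-FLOOR: along an immortal smooth cylinder flow `IsCylinderMCF M F ν T` of a compact connected
cross-section of `N = S⁴ × ℝ ⊂ ℝ⁶` with separating `2`-thin slices, some slice has area
`≤ (1+ε) μH⁴(S⁴)`.  Reshape r7 splits this into

* the DISSIPATION BUDGET (parabolic, registered stub `stub_dissipationBudget`):
  `∫_T^t ∫_M ‖∂_r F‖² d((F r)^*μH⁴) dr + μH⁴(M_t) ≤ μH⁴(M_T)`;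
* AREA QUANTIZATION (the flow-free GMT core, registered stub `stub_areaQuantization`): slab-confined
  separating embedded cross-sections `ι_k` with smooth unit normals, `∫ H_k² → 0` and areas `→ A < ⊤`
  have `A ∈ ℕ · μH⁴(S⁴)`;

and this file PROVES the glue `helper_areaToFloorOfQuantization : DissipationBudget → AreaQuantization →
AreaToFloor` (all three spelled out over the landed vocabulary):

1. the areas `a(t) = μH⁴(M_t)` are antitone on `[T, ∞)` (landed `stub_areaDissipation`), `≥ vol S⁴`
   (area floor, tree `hausdorffMeasure_sphere_le_of_separatesEnds`) and `< 2 vol S⁴`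
   (`measure_ratio_le_cylEntropy`); the conclusion is equivalent to `⨅_{t ≥ T} a(t) ≤ vol S⁴`
   (`areaToFloor_iff_iInf_le`, pure `ℝ≥0∞` bookkeeping);
2. the budget forces the speed integral `f(r) = ∫ ‖∂_r F‖² dμ_r` below `1/(n+1)` at some time
   `r_n ≥ T + n` (otherwise `∫_{T+n}^{T+n+L} f ≥ L/(n+1)` exceeds `a(T)`), so `f(r_n) → 0`, while
   `a(r_n) → A_∞ = ⨅_{t ≥ T} a(t)` by antitonicity;
3. `‖∂_r F‖ = |H|` (`velocity_eq`, `‖ν‖ = 1`), so `∫ H² dμ_{r_n} = f(r_n) → 0`; slab confinement (landed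
   `stub_slabConfinement`) bounds all heights; quantization gives `A_∞ = m · vol S⁴` with `m ∈ ℕ`, and
   `vol ≤ A_∞ < 2 vol` forces `m = 1`.

Everything here is PROVED (no `sorry`, no new definitions, no named facts).

References: K. Brakke, *The motion of a surface by its mean curvature* (1978), §3 (area as Lyapunov
function); W. K. Allard, *On the first variation of a varifold*, Ann. of Math. 95 (1972), §6 (the
quantization input, taken as the hypothesis `AreaQuantization`).
-/

noncomputable section

-- the prescribed namespace `Summit.SmoothPoincare4.SmoothPoincare4.…` repeats `SmoothPoincare4`
set_option linter.dupNamespace false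

open MeasureTheory Set Filter
open scoped Manifold ContDiff ENNReal Topology BigOperators

namespace Summit.SmoothPoincare4.SmoothPoincare4.Cruxes.CylinderRungTwo.KillingFlux

open Literature.Geometry.Riemannian
open Literature.Geometry.Lorentzian Literature.Geometry.Lorentzian.PseudoRiemannianMetric
open Literature.Geometry.Riemannian.SphericalCylinderEntropy
open Summit.SmoothPoincare4.SmoothPoincare4.Theorems.CylinderRungTwo.KillingFlux (norm_nu)

/-! ## Bookkeeping on the areas of the time slices -/

/-- Area floor for a separating set, in the vocabulary's `SeparatesEnds` spelling (tree
`hausdorffMeasure_sphere_le_of_separatesEnds`). [folklore] -/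
theorem floor_le_of_separatesEnds {A : Set (EuclideanSpace ℝ (Fin 6))} (hsep : SeparatesEnds A) :
    μH[4] (Metric.sphere (0 : EuclideanSpace ℝ (Fin 5)) 1) ≤ μH[4] A := by
  obtain ⟨R, hR⟩ := hsep
  exact hausdorffMeasure_sphere_le_of_separatesEnds hR

section Flow

variable {M : Type} [TopologicalSpace M] [ChartedSpace (EuclideanSpace ℝ (Fin 4)) M]
  [IsManifold (𝓡 4) ∞ M] [CompactSpace M]
  {F ν : ℝ → M → EuclideanSpace ℝ (Fin 6)} {T : ℝ}

/-- The time slices of a cylinder flow of a compact cross-section are compact. [folklore] -/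
theorem IsCylinderMCF.isCompact_range (hF : IsCylinderMCF M F ν T) {t : ℝ} (ht : T ≤ t) :
    IsCompact (Set.range (F t)) :=
  _root_.isCompact_range (hF.isSmoothEmbedding t ht).isEmbedding.continuous

/-- **`μH⁴(M_t) < 2 μH⁴(S⁴)` from `λ_cyl(M_t) < 2`** (tree `measure_ratio_le_cylEntropy`; the range is
compact, hence measurable and of bounded height, and lies in `N`). [folklore] -/
theorem IsCylinderMCF.measure_range_lt_two_mul (hF : IsCylinderMCF M F ν T) {t : ℝ} (ht : T ≤ t)
    (hthin : cylEntropy (Set.range (F t)) < 2) :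
    μH[4] (Set.range (F t)) < 2 * μH[4] (Metric.sphere (0 : EuclideanSpace ℝ (Fin 5)) 1) := by
  have hcpt := hF.isCompact_range ht
  have hmeas : MeasurableSet (Set.range (F t)) := hcpt.isClosed.measurableSet
  obtain ⟨B, hB⟩ := hcpt.isBounded.exists_norm_le
  have hB' : ∀ z ∈ Set.range (F t), |z 5| ≤ B := fun z hz =>
    le_trans (by simpa [Real.norm_eq_abs] using PiLp.norm_apply_le z 5) (hB z hz)
  have hN : ∀ z ∈ Set.range (F t), ∑ i : Fin 5, z (Fin.castSucc i) ^ 2 = 1 := by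
    rintro z ⟨x, rfl⟩
    exact hF.mem_cyl t ht x
  have key : (μH[4] (Metric.sphere (0 : EuclideanSpace ℝ (Fin 5)) 1))⁻¹ * μH[4] (Set.range (F t)) < 2 :=
    lt_of_le_of_lt (measure_ratio_le_cylEntropy hmeas hN hB') hthin
  have h0 := hausdorffMeasure_sphere_four_pos.ne'
  have htop := hausdorffMeasure_sphere_four_lt_top.ne
  calc μH[4] (Set.range (F t))
      = μH[4] (Metric.sphere (0 : EuclideanSpace ℝ (Fin 5)) 1) *
          ((μH[4] (Metric.sphere (0 : EuclideanSpace ℝ (Fin 5)) 1))⁻¹ * μH[4] (Set.range (F t))) := by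
        rw [← mul_assoc, ENNReal.mul_inv_cancel h0 htop, one_mul]
    _ < μH[4] (Metric.sphere (0 : EuclideanSpace ℝ (Fin 5)) 1) * 2 :=
        ENNReal.mul_lt_mul_right h0 htop key
    _ = 2 * μH[4] (Metric.sphere (0 : EuclideanSpace ℝ (Fin 5)) 1) := mul_comm _ _

/-- **Uniform height bound along the flow** (landed `stub_slabConfinement` + compactness of the initial
slice): `|(F t x)₅| ≤ B` for all `t ≥ T`, `x`. [folklore] -/
theorem IsCylinderMCF.exists_height_bound [T2Space M] [SecondCountableTopology M]
    (hF : IsCylinderMCF M F ν T) : ∃ B : ℝ, ∀ t, T ≤ t → ∀ x : M, |F t x 5| ≤ B := by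
  obtain ⟨B, hB⟩ := (hF.isCompact_range le_rfl).isBounded.exists_norm_le
  refine ⟨B, fun t ht x => ?_⟩
  obtain ⟨y, y', hy, hy'⟩ := stub_slabConfinement M F ν T hF t ht x
  have h1 : |F T y 5| ≤ B :=
    le_trans (by simpa [Real.norm_eq_abs] using PiLp.norm_apply_le (F T y) 5) (hB _ ⟨y, rfl⟩)
  have h2 : |F T y' 5| ≤ B :=
    le_trans (by simpa [Real.norm_eq_abs] using PiLp.norm_apply_le (F T y') 5) (hB _ ⟨y', rfl⟩)
  rw [abs_le] at h1 h2 ⊢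
  exact ⟨by linarith [h1.1], by linarith [h2.2]⟩

omit [CompactSpace M] in
/-- **The speed is the mean curvature**: `‖∂_r F(r, x)‖ ^ 2 = H(r, x) ^ 2` along a cylinder flow
(`velocity_eq`: `∂_r F = -H ν` with `‖ν‖ = 1`; `deriv` and `mfderiv … 1` agree for maps between vector
spaces). [folklore] -/
theorem IsCylinderMCF.norm_deriv_sq (hF : IsCylinderMCF M F ν T) {r : ℝ} (hr : T ≤ r) (x : M) :
    ‖deriv (fun s => F s x) r‖ ^ 2 =
      (euclideanMetric (EuclideanSpace ℝ (Fin 6))).meanCurvature (F r) contMDiff_pullbackBilin_holds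
        (hF.isSpacelikeImmersion r hr) (ν r) x ^ 2 := by
  have hv := hF.velocity_eq r hr x
  rw [mfderiv_eq_fderiv] at hv
  have hd : deriv (fun s => F s x) r =
      -((euclideanMetric (EuclideanSpace ℝ (Fin 6))).meanCurvature (F r) contMDiff_pullbackBilin_holds
        (hF.isSpacelikeImmersion r hr) (ν r) x) • ν r x := by
    rw [← fderiv_apply_one_eq_deriv]
    exact hv
  rw [hd, norm_smul, norm_neg, Real.norm_eq_abs, norm_nu (hF.isUnitNormal r hr) x, mul_one, sq_abs]

end Flow

/-- For any family `a : ℝ → ℝ≥0∞`, "`∀ ε > 0, ∃ t ≥ T, a t ≤ (1+ε) vol S⁴`" is EQUIVALENT to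
`⨅_{t ≥ T} a t ≤ vol S⁴` (because `0 < vol S⁴ < ⊤`). [folklore] -/
theorem areaToFloor_iff_iInf_le (a : ℝ → ℝ≥0∞) (T : ℝ) :
    (∀ ε : ℝ, 0 < ε → ∃ t : ℝ, T ≤ t ∧
        a t ≤ ENNReal.ofReal (1 + ε) * μH[4] (Metric.sphere (0 : EuclideanSpace ℝ (Fin 5)) 1)) ↔
      ⨅ t ∈ Set.Ici T, a t ≤ μH[4] (Metric.sphere (0 : EuclideanSpace ℝ (Fin 5)) 1) := by
  set V := μH[4] (Metric.sphere (0 : EuclideanSpace ℝ (Fin 5)) 1) with hV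
  have h0 : V ≠ 0 := hausdorffMeasure_sphere_four_pos.ne'
  have htop : V ≠ ⊤ := hausdorffMeasure_sphere_four_lt_top.ne
  constructor
  · intro h
    refine ENNReal.le_of_forall_pos_le_add fun δ hδ _ => ?_
    have hVr : 0 < V.toReal := ENNReal.toReal_pos h0 htop
    obtain ⟨t, ht, hle⟩ := h ((δ : ℝ) / V.toReal) (div_pos (by exact_mod_cast hδ) hVr)
    calc ⨅ t ∈ Set.Ici T, a t ≤ a t := iInf₂_le t (Set.mem_Ici.2 ht)
      _ ≤ ENNReal.ofReal (1 + δ / V.toReal) * V := hle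
      _ = V + (δ : ℝ≥0∞) := by
          rw [ENNReal.ofReal_add zero_le_one (div_pos (by exact_mod_cast hδ) hVr).le,
            ENNReal.ofReal_one, add_mul, one_mul, ENNReal.ofReal_div_of_pos hVr,
            ENNReal.ofReal_toReal htop, ENNReal.ofReal_coe_nnreal,
            ENNReal.div_mul_cancel h0 htop]
  · intro h ε hε
    have hlt : ⨅ t ∈ Set.Ici T, a t < ENNReal.ofReal (1 + ε) * V := by
      refine lt_of_le_of_lt h ?_
      calc V = 1 * V := (one_mul _).symm
        _ < ENNReal.ofReal (1 + ε) * V := by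
            refine ENNReal.mul_lt_mul_left h0 htop ?_
            rw [← ENNReal.ofReal_one]
            exact (ENNReal.ofReal_lt_ofReal_iff (by linarith)).2 (by linarith)
    obtain ⟨t, ht⟩ := iInf_lt_iff.1 hlt
    obtain ⟨hT, hlt'⟩ := iInf_lt_iff.1 ht
    exact ⟨t, Set.mem_Ici.1 hT, hlt'.le⟩

/-- **A finite space-time budget forces small slices**: if `∫_{t₀}^{t₀+L} f ≤ C < ⊤` for all `L ≥ 0`
then for every `δ > 0` some `r ≥ t₀` has `f r < δ` (otherwise the integral over `[t₀, t₀ + L]` is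
`≥ δ L`). No measurability of `f` is needed. [folklore] -/
theorem exists_lt_of_setLIntegral_le {f : ℝ → ℝ≥0∞} {t₀ : ℝ} {C : ℝ≥0∞} (hC : C ≠ ⊤)
    (hbud : ∀ L : ℝ, 0 ≤ L → ∫⁻ r in Set.Icc t₀ (t₀ + L), f r ≤ C) {δ : ℝ} (hδ : 0 < δ) :
    ∃ r : ℝ, t₀ ≤ r ∧ f r < ENNReal.ofReal δ := by
  by_contra hcon
  simp only [not_exists, not_and, not_lt] at hcon
  -- `f ≥ δ` on `[t₀, ∞)`; integrate over `[t₀, t₀ + L]` with `δ L = C.toReal + 1`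
  set L : ℝ := (C.toReal + 1) / δ with hL
  have hLpos : 0 ≤ L := by positivity
  have hδL : δ * L = C.toReal + 1 := by
    rw [hL]; field_simp
  have hge : ENNReal.ofReal δ * volume (Set.Icc t₀ (t₀ + L)) ≤ ∫⁻ r in Set.Icc t₀ (t₀ + L), f r := by
    rw [← setLIntegral_const]
    exact setLIntegral_mono' measurableSet_Icc fun r hr => hcon r hr.1
  rw [Real.volume_Icc, add_sub_cancel_left, ← ENNReal.ofReal_mul hδ.le, hδL] at hge
  have h := le_trans hge (hbud L hLpos)
  have h' : C.toReal + 1 ≤ C.toReal := by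
    have := (ENNReal.ofReal_le_iff_le_toReal hC).1 h
    exact this
  linarith

/-- **Registered helper `helper_areaToFloorOfQuantization` (line `killing-flux`, crux
`CylinderEntropy.CylinderRungTwo`, stmt-SmoothPoincare4-7631; lead reshape r7):
`DissipationBudget → AreaQuantization → AreaToFloor`.** See the module docstring for the proof. -/
theorem helper_areaToFloorOfQuantization :
    (∀ (M : Type) [TopologicalSpace M] [T2Space M] [SecondCountableTopology M]
      [ChartedSpace (EuclideanSpace ℝ (Fin 4)) M] [IsManifold (𝓡 4) ∞ M] [CompactSpace M]
      [MeasurableSpace M] [BorelSpace M]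
      (F : ℝ → M → EuclideanSpace ℝ (Fin 6)) (ν : ℝ → M → EuclideanSpace ℝ (Fin 6)) (T : ℝ),
      IsCylinderMCF M F ν T →
      ∀ t, T ≤ t →
        (∫⁻ r in Set.Icc T t, ∫⁻ x, ENNReal.ofReal
            (‖deriv (fun s => F s x) r‖ ^ 2)
            ∂(Measure.comap (F r) (μH[4] : Measure (EuclideanSpace ℝ (Fin 6))))) +
          μH[4] (Set.range (F t)) ≤ μH[4] (Set.range (F T))) →
    (∀ (M : Type) [TopologicalSpace M] [T2Space M] [SecondCountableTopology M]
      [ChartedSpace (EuclideanSpace ℝ (Fin 4)) M] [IsManifold (𝓡 4) ∞ M] [CompactSpace M] [ConnectedSpace M]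
      [MeasurableSpace M] [BorelSpace M]
      (ι : ℕ → M → EuclideanSpace ℝ (Fin 6)) (ν : ℕ → M → EuclideanSpace ℝ (Fin 6)),
      (∀ k, Manifold.IsSmoothEmbedding (𝓡 4) (𝓡 6) ∞ (ι k)) →
      (∀ k x, ∑ i : Fin 5, ι k x (Fin.castSucc i) ^ 2 = 1) →
      (∀ k, SeparatesEnds (Set.range (ι k))) →
      ∀ himm : ∀ k, (euclideanMetric (EuclideanSpace ℝ (Fin 6))).IsSpacelikeImmersion (𝓡 4) (ι k),
      (∀ k, (euclideanMetric (EuclideanSpace ℝ (Fin 6))).IsUnitNormal (𝓡 4) (ι k) (ν k) 1) →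
      (∀ k x, ∑ i : Fin 5, ν k x (Fin.castSucc i) * ι k x (Fin.castSucc i) = 0) →
      (∀ k, ContMDiff (𝓡 4) (𝓡 6) ∞ (ν k)) →
      ∀ B : ℝ, (∀ k x, |ι k x 5| ≤ B) →
      Filter.Tendsto (fun k => ∫⁻ x, ENNReal.ofReal
          ((euclideanMetric (EuclideanSpace ℝ (Fin 6))).meanCurvature (ι k) contMDiff_pullbackBilin_holds (himm k)
            (ν k) x ^ 2) ∂(Measure.comap (ι k) (μH[4] : Measure (EuclideanSpace ℝ (Fin 6))))) Filter.atTop (𝓝 0) →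
      ∀ A : ℝ≥0∞, A < ⊤ →
      Filter.Tendsto (fun k => μH[4] (Set.range (ι k))) Filter.atTop (𝓝 A) →
      ∃ m : ℕ, A = m * μH[4] (Metric.sphere (0 : EuclideanSpace ℝ (Fin 5)) 1)) →
    ∀ (M : Type) [TopologicalSpace M] [T2Space M] [SecondCountableTopology M]
      [ChartedSpace (EuclideanSpace ℝ (Fin 4)) M] [IsManifold (𝓡 4) ∞ M] [CompactSpace M]
      [ConnectedSpace M]
      (F : ℝ → M → EuclideanSpace ℝ (Fin 6)) (ν : ℝ → M → EuclideanSpace ℝ (Fin 6)) (T : ℝ),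
      IsCylinderMCF M F ν T →
      (∀ t, T ≤ t → SeparatesEnds (Set.range (F t))) →
      (∀ t, T ≤ t → cylEntropy (Set.range (F t)) < 2) →
      ∀ ε : ℝ, 0 < ε → ∃ t : ℝ, T ≤ t ∧
        μH[4] (Set.range (F t)) ≤
          ENNReal.ofReal (1 + ε) * μH[4] (Metric.sphere (0 : EuclideanSpace ℝ (Fin 5)) 1) := by
  intro hbud hquant M _ _ _ _ _ _ _ F ν T hflow hsep hent
  -- Borel structure on `M` (the budget and the quantization are stated for Borel cross-sections)
  letI : MeasurableSpace M := borel M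
  haveI : BorelSpace M := ⟨rfl⟩
  set V : ℝ≥0∞ := μH[4] (Metric.sphere (0 : EuclideanSpace ℝ (Fin 5)) 1) with hV
  have hV0 : V ≠ 0 := hausdorffMeasure_sphere_four_pos.ne'
  have hVtop : V ≠ ⊤ := hausdorffMeasure_sphere_four_lt_top.ne
  -- the areas
  set a : ℝ → ℝ≥0∞ := fun t => μH[4] (Set.range (F t)) with ha
  rw [areaToFloor_iff_iInf_le a T]
  set Ainf : ℝ≥0∞ := ⨅ t ∈ Set.Ici T, a t with hAinf
  have hfloor : ∀ t, T ≤ t → V ≤ a t := fun t ht => floor_le_of_separatesEnds (hsep t ht)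
  have haT : a T < 2 * V := hflow.measure_range_lt_two_mul le_rfl (hent T le_rfl)
  have haTtop : a T ≠ ⊤ := (lt_of_lt_of_le haT (by
    exact le_top)).ne
  have hanti : AntitoneOn a (Set.Ici T) := stub_areaDissipation M F ν T hflow
  have hAinf_le : ∀ t, T ≤ t → Ainf ≤ a t := fun t ht => iInf₂_le t (Set.mem_Ici.2 ht)
  have hV_le : V ≤ Ainf := le_iInf₂ fun t ht => hfloor t (Set.mem_Ici.1 ht)
  have hAinf_lt : Ainf < 2 * V := lt_of_le_of_lt (hAinf_le T le_rfl) haT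
  have hAinf_top : Ainf < ⊤ := lt_of_lt_of_le hAinf_lt le_top
  -- the speed integral and its budget
  set f : ℝ → ℝ≥0∞ := fun r => ∫⁻ x, ENNReal.ofReal (‖deriv (fun s => F s x) r‖ ^ 2)
      ∂(Measure.comap (F r) (μH[4] : Measure (EuclideanSpace ℝ (Fin 6)))) with hf
  have hbudget : ∀ t, T ≤ t → ∫⁻ r in Set.Icc T t, f r ≤ a T := fun t ht =>
    le_trans le_self_add (hbud M F ν T hflow t ht)
  -- small speed at arbitrarily late times
  have hsmall : ∀ n : ℕ, ∃ r : ℝ, T + n ≤ r ∧ f r < ENNReal.ofReal (1 / ((n : ℝ) + 1)) := by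
    intro n
    refine exists_lt_of_setLIntegral_le (t₀ := T + n) haTtop (fun L hL => ?_) (by positivity)
    have hn : (0 : ℝ) ≤ n := Nat.cast_nonneg n
    calc ∫⁻ r in Set.Icc (T + n) (T + n + L), f r ≤ ∫⁻ r in Set.Icc T (T + n + L), f r :=
          lintegral_mono_set (Set.Icc_subset_Icc_left (by linarith))
      _ ≤ a T := hbudget _ (by linarith)
  choose r hrT hrf using hsmall
  have hr : ∀ n, T ≤ r n := fun n =>
    le_trans (le_add_of_nonneg_right (Nat.cast_nonneg n)) (hrT n)
  -- `f (r n) → 0`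
  have hf0 : Tendsto (fun n => f (r n)) atTop (𝓝 0) := by
    have h1 : Tendsto (fun n : ℕ => ENNReal.ofReal (1 / ((n : ℝ) + 1))) atTop (𝓝 0) := by
      rw [← ENNReal.ofReal_zero]
      exact ENNReal.tendsto_ofReal tendsto_one_div_add_atTop_nhds_zero_nat
    exact tendsto_of_tendsto_of_tendsto_of_le_of_le tendsto_const_nhds h1 (fun _ => bot_le)
      fun n => (hrf n).le
  -- `a (r n) → Ainf`
  have hrtop : Tendsto r atTop atTop := by
    refine tendsto_atTop_mono hrT ?_
    exact tendsto_atTop_add_const_left _ _ tendsto_natCast_atTop_atTop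
  have haA : Tendsto (fun n => a (r n)) atTop (𝓝 Ainf) := by
    refine tendsto_order.2 ⟨fun b hb => Eventually.of_forall fun n => lt_of_lt_of_le hb (hAinf_le _ (hr n)),
      fun b hb => ?_⟩
    obtain ⟨t₁, ht₁⟩ := iInf_lt_iff.1 hb
    obtain ⟨hT₁, hlt₁⟩ := iInf_lt_iff.1 ht₁
    filter_upwards [hrtop.eventually_ge_atTop t₁] with n hn
    exact lt_of_le_of_lt (hanti hT₁ (Set.mem_Ici.2 (hr n)) hn) hlt₁
  -- the quantization hypotheses for `ι n = F (r n)`, `ν n = ν (r n)`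
  obtain ⟨B, hB⟩ := hflow.exists_height_bound
  have hH0 : Tendsto (fun n => ∫⁻ x, ENNReal.ofReal
      ((euclideanMetric (EuclideanSpace ℝ (Fin 6))).meanCurvature (F (r n)) contMDiff_pullbackBilin_holds
        (hflow.isSpacelikeImmersion (r n) (hr n)) (ν (r n)) x ^ 2)
      ∂(Measure.comap (F (r n)) (μH[4] : Measure (EuclideanSpace ℝ (Fin 6))))) atTop (𝓝 0) := by
    refine hf0.congr fun n => ?_
    simp only [hf]
    refine lintegral_congr fun x => ?_
    rw [hflow.norm_deriv_sq (hr n) x]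
  obtain ⟨m, hm⟩ := hquant M (fun n => F (r n)) (fun n => ν (r n))
    (fun n => hflow.isSmoothEmbedding (r n) (hr n)) (fun n x => hflow.mem_cyl (r n) (hr n) x)
    (fun n => hsep (r n) (hr n)) (fun n => hflow.isSpacelikeImmersion (r n) (hr n))
    (fun n => hflow.isUnitNormal (r n) (hr n)) (fun n x => hflow.normal_tangent (r n) (hr n) x)
    (fun n => hflow.contMDiff_normal (r n) (hr n)) B (fun n x => hB (r n) (hr n) x) hH0 Ainf hAinf_top haA
  -- `vol ≤ m vol < 2 vol` forces `m = 1`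
  have hm1 : m = 1 := by
    rcases Nat.lt_or_ge m 2 with hlt | hge
    · interval_cases m
      · exfalso
        rw [hm, Nat.cast_zero, zero_mul] at hV_le
        exact hV0 (le_antisymm hV_le bot_le)
      · rfl
    · exfalso
      have : (2 : ℝ≥0∞) * V ≤ Ainf := by
        rw [hm]
        gcongr
        exact_mod_cast hge
      exact absurd hAinf_lt (not_lt.2 this)
  rw [hm, hm1, Nat.cast_one, one_mul]

end Summit.SmoothPoincare4.SmoothPoincare4.Cruxes.CylinderRungTwo.KillingFlux

end
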